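import Summits.HodgeConjecture.CorCM.Census.NondegenerateSplitting
import Summits.HodgeConjecture.CorCM.Census.HalfParityExampleQ8

/-!
# The quaternion law, base case: `μ(Q₈, −1) = φ₂(Q₈, −1)` by the splitting method — ONE face, one nondegenerate type, no table

COR-CM (cell `pub-hodgecm2`), count-neutral kernel combinatorics by the binder seat b09 (gen 38; lane TWO-ADIC SPLITTING +
NONDEGENERATE REDUCTION, part H = the first ROW produced by parts A–G), on top of part D `Census/NondegenerateSplitting.lean`
(`isLeast_card_gfaces_generate_of_reduction`), part A `Census/NondegenerateReduction.lean` (`nondegenerate_of_cert`; the certificate is the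
arc-doubling certificate of part F `Census/NondegenerateDoubling.lean`, written out), and seat b09ʼs `Census/HalfParityExampleQ8.lean` (gen 30: the model `G = QuaternionGroup 2`, `c = a 2`, the types `T`, `TfA`, `TfX`, `TfAX`, the witness face
`f_A = gface T (a 0) (xa 0)` with `hsum A (red f_A) = 1`, `mem_of_card_eq`) used BY NAME.  Theorems only; the finite checks are `decide` over the
group of order `8` (no enumeration of the `16` types beyond one cardinality); no named fact, no `sorry`.
HONEST FRAMING: `HC_CM` is NOT proved, here or anywhere in the tree; nothing here is a period or a headline.

**THEOREM (`isLeast_card_gfaces_generate_quaternionEight`).**  For `G = Q₈` and its central involution `c = −1`, the least number of rank-four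
face relations whose base changes generate the integer Hodge lattice modulo the pairs is EXACTLY the coinvariant fibre dimension `φ₂(Q₈, −1)`
(`≥ 2` by `HalfParity.ExampleQ8.two_le_halfRank`; numerically `= 2`) — the base row `M = 2` of the quaternion column `Q_{4M}`
(`HOME/pub-hodgecm2-b09/lean-g38/SPLITTING-METHOD.md` §WHAT IS LEFT (1)), obtained WITHOUT any generating table:

1. the standard type `T = {1, i} ⊔ j·{1, i} = {a 0, a 1, xa 0, xa 1}` is NONDEGENERATE: quasi-inverse `t = (δ₁ − δ_i)·(1 − δ_{j})`,
   `t·Σ_{y∈T} y ≡ 4` modulo `(1 + c)` (the arc of `u = a 1` doubled by `x = xa 0`, `x² = c`, cf. part F), one `decide`;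
2. ONE face `f_A = [T] + [T·(a 3)⁻¹] − [TfA] − [TfA·(xa 1)⁻¹]` reduces every type onto `ℤ[G]·[T]` up to `2`: its base change along `xa 1` returns
   `TfA·(xa 1)⁻²  = TfA·c⁻¹ = T̄fA`, so `f_A − f_A·(xa 1)⁻¹ ≡ −2[TfA] + pair(TfA)` modulo base changes of `[T]` (`two_smul_single_TfA_mem`), and every
   type is a base change of `T` or of `TfA` (`eq_rt_T_or_rt_TfA`, one cardinality `decide`);
3. `f_A` is fibre-independent (its half-parity `hsum A` is `1`, and half-parities kill `rad2`);
4. part D: `μ = φ₂`.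

## References
* [Pohlmann1968] H. Pohlmann, Algebraic cycles on abelian varieties of complex multiplication type, Ann. of Math. 88 (1968), Thm 1.
-/

namespace Summit.HodgeConjecture.CorCM.Census.QuaternionEight

open Finset QuaternionGroup
open Summit.HodgeConjecture.CorCM.Prior.AllgGroup.RfwfAllgGroup
open Summit.HodgeConjecture.CorCM.Census.BlockParity
open Summit.HodgeConjecture.CorCM.Census.Coinvariant
open Summit.HodgeConjecture.CorCM.Census.HalfParity
open Summit.HodgeConjecture.CorCM.Census.HalfParity.ExampleQ8
open Summit.HodgeConjecture.CorCM.Census.Nondegenerate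
open Summit.HodgeConjecture.CorCM.Census.Splitting
open Summit.HodgeConjecture.CorCM.Census.TwistGeneration

noncomputable section

/-! ## §1 The two blocks: every type is a base change of `T` or of `TfA` -/

/-- The base changes of `T` and of `TfA` are `16` types. [folklore] -/
theorem card_orbits : ((univ : Finset G).image (fun Q => rt c Q T) ∪ (univ : Finset G).image (fun Q => rt c Q TfA)).card = 16 := by
  decide

/-- **Every abstract CM type of `(Q₈, −1)` is a base change of `T` or of `TfA`.** [folklore] -/
theorem eq_rt_T_or_rt_TfA (Φ : CMF G c) : (∃ Q : G, Φ = rt c Q T) ∨ ∃ Q : G, Φ = rt c Q TfA := by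
  have h := mem_of_card_eq card_orbits Φ
  rcases mem_union.mp h with h | h
  · obtain ⟨Q, -, hQ⟩ := mem_image.mp h
    exact Or.inl ⟨Q, hQ.symm⟩
  · obtain ⟨Q, -, hQ⟩ := mem_image.mp h
    exact Or.inr ⟨Q, hQ.symm⟩

/-! ## §2 The one-face reduction -/

/-- The witness face `f_A = gface T (a 0) (xa 0)`. [folklore] -/
theorem fA_mem_gfaceSet : gface c c_mul_c T (a 0) (xa 0) ∈ gfaceSet G c c_mul_c := ⟨T, a 0, xa 0, notMem_orb.1, rfl⟩

/-- `(xa 1)² = c` and the two base changes of the far corners. [folklore] -/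
theorem rt_xa_one : rt c (xa 1) TfX = rt c c TfA ∧ rt c (xa 1) TfAX = rt c (xa 1 * a 3) T ∧ rt c (xa 1) TfA = TfX := by
  refine ⟨?_, ?_, corners_rt.2.1.symm⟩
  · rw [corners_rt.2.1, ← rt_mul, show (xa 1 : G) * xa 1 = c by decide]
  · rw [corners_rt.1, ← rt_mul]

/-- **The key congruence**: `2·[TfA] ∈ ℤ⟨pairs⟩ + ℤ⟨base changes of f_A⟩ + ℤ⟨base changes of [T]⟩`. [folklore] -/
theorem two_smul_single_TfA_mem :
    ((2 : ℤ) ^ 1) • Finsupp.single TfA (1 : ℤ) ∈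
      (Submodule.span ℤ (pairSet c) ⊔ Submodule.span ℤ (translates c ({gface c c_mul_c T (a 0) (xa 0)} : Finset (CMF G c →₀ ℤ)))) ⊔
        Submodule.span ℤ (Set.range fun Q : G => Finsupp.single (rt c Q T) (1 : ℤ)) := by
  set fA := gface c c_mul_c T (a 0) (xa 0) with hfA_def
  set g := Finsupp.mapDomain (rt c (xa 1)) fA with hg_def
  have hfA : fA = Finsupp.single T 1 + Finsupp.single TfAX 1 - Finsupp.single TfA 1 - Finsupp.single TfX 1 := gface_A
  have hg : g = Finsupp.single (rt c (xa 1) T) 1 + Finsupp.single (rt c (xa 1 * a 3) T) 1 - Finsupp.single TfX 1 -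
      Finsupp.single (rt c c TfA) 1 := by
    rw [hg_def, hfA]
    simp only [Finsupp.mapDomain_add, Finsupp.mapDomain_sub, Finsupp.mapDomain_single]
    rw [rt_xa_one.1, rt_xa_one.2.1, rt_xa_one.2.2]
  have e : ((2 : ℤ) ^ 1) • Finsupp.single TfA (1 : ℤ) =
      (Finsupp.single T 1 + Finsupp.single TfAX 1 - Finsupp.single (rt c (xa 1) T) 1 - Finsupp.single (rt c (xa 1 * a 3) T) 1) +
        pair c TfA - fA + g := by
    rw [hfA, hg, pair, pow_one, two_smul]
    abel
  rw [e]
  have hB : ∀ Q : G, Finsupp.single (rt c Q T) (1 : ℤ) ∈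
      Submodule.span ℤ (Set.range fun Q : G => Finsupp.single (rt c Q T) (1 : ℤ)) := fun Q => Submodule.subset_span ⟨Q, rfl⟩
  refine Submodule.add_mem _ (Submodule.sub_mem _ (Submodule.add_mem _ (Submodule.mem_sup_right ?_)
    (Submodule.mem_sup_left (Submodule.mem_sup_left (Submodule.subset_span (pair_mem_pairSet c TfA)))))
    (Submodule.mem_sup_left (Submodule.mem_sup_right (mem_span_translates_of_mem c _ (mem_singleton_self _)))))
    (Submodule.mem_sup_left (Submodule.mem_sup_right ?_))
  · refine Submodule.sub_mem _ (Submodule.sub_mem _ (Submodule.add_mem _ ?_ ?_) (hB _)) (hB _)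
    · have h := hB 1; rwa [rt_one] at h
    · have h := hB (a 3); rwa [← corners_rt.1] at h
  · exact Submodule.subset_span ⟨xa 1, fA, mem_singleton_self _, rfl⟩

/-- The target lattice `ℤ⟨pairs⟩ + ℤ⟨base changes of f_A⟩ + ℤ⟨base changes of [T]⟩` is base-change stable. [folklore] -/
theorem mapDomain_rt_mem_target (Q : G) {y : CMF G c →₀ ℤ}
    (hy : y ∈ (Submodule.span ℤ (pairSet c) ⊔ Submodule.span ℤ (translates c ({gface c c_mul_c T (a 0) (xa 0)} : Finset _))) ⊔
      Submodule.span ℤ (Set.range fun Q : G => Finsupp.single (rt c Q T) (1 : ℤ))) :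
    Finsupp.mapDomain (rt c Q) y ∈
      (Submodule.span ℤ (pairSet c) ⊔ Submodule.span ℤ (translates c ({gface c c_mul_c T (a 0) (xa 0)} : Finset _))) ⊔
        Submodule.span ℤ (Set.range fun Q : G => Finsupp.single (rt c Q T) (1 : ℤ)) := by
  obtain ⟨l, hl, b, hb, rfl⟩ := Submodule.mem_sup.mp hy
  rw [Finsupp.mapDomain_add]
  refine Submodule.add_mem _ (Submodule.mem_sup_left (mapDomain_rt_mem_psp c c_comm Q _ hl)) (Submodule.mem_sup_right ?_)
  have hle : Submodule.map (Finsupp.lmapDomain ℤ ℤ (rt c Q)) (Submodule.span ℤ (Set.range fun Q : G => Finsupp.single (rt c Q T) (1 : ℤ))) ≤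
      Submodule.span ℤ (Set.range fun Q : G => Finsupp.single (rt c Q T) (1 : ℤ)) := by
    rw [Submodule.map_span, Submodule.span_le]
    rintro _ ⟨_, ⟨Q', rfl⟩, rfl⟩
    rw [Finsupp.lmapDomain_apply, Finsupp.mapDomain_single, ← rt_mul]
    exact Submodule.subset_span ⟨Q * Q', rfl⟩
  exact hle (Submodule.mem_map_of_mem hb)

/-- **COMPLETE REDUCTION up to `2`**: every type of `(Q₈, −1)` satisfies `2·[Φ] ∈ ℤ⟨pairs⟩ + ℤ⟨base changes of f_A⟩ + ℤ⟨base changes of [T]⟩`.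
[folklore] -/
theorem reduction (Φ : CMF G c) :
    ((2 : ℤ) ^ 1) • Finsupp.single Φ (1 : ℤ) ∈
      (Submodule.span ℤ (pairSet c) ⊔ Submodule.span ℤ (translates c ({gface c c_mul_c T (a 0) (xa 0)} : Finset (CMF G c →₀ ℤ)))) ⊔
        Submodule.span ℤ (Set.range fun Q : G => Finsupp.single (rt c Q T) (1 : ℤ)) := by
  rcases eq_rt_T_or_rt_TfA Φ with ⟨Q, rfl⟩ | ⟨Q, rfl⟩
  · exact Submodule.smul_mem _ _ (Submodule.mem_sup_right (Submodule.subset_span ⟨Q, rfl⟩))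
  · have h := mapDomain_rt_mem_target Q two_smul_single_TfA_mem
    rwa [Finsupp.mapDomain_smul, Finsupp.mapDomain_single] at h

/-! ## §3 Nondegeneracy of `T`, fibre-independence of `f_A`, and THE LAW -/

/-- **`T = {1, i} ⊔ j{1, i}` is nondegenerate**: the quasi-inverse certificate `t = (δ₁ − δ_i)(1 − δ_j·)` of exponent `2` (the arc of `a 1` doubled by `xa 0`, `(xa 0)² = c`, as in part F `Nondegenerate.cert_arc_double`), checked by `decide` over the `8` elements. [folklore] -/
theorem nondegenerate_T : ∀ f : G → ℤ, (∀ Q, f (c * Q) = -f Q) → (∀ y, ∑ Q, f Q * indG T.1 (y * Q) = 0) → ∀ Q, f Q = 0 :=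
  nondegenerate_of_cert c c_mul_c c_comm T
    (fun y => ((if y = 1 then (1 : ℤ) else 0) - (if y = a 1 then 1 else 0)) -
      ((if y * (xa 0)⁻¹ = 1 then (1 : ℤ) else 0) - (if y * (xa 0)⁻¹ = a 1 then 1 else 0)))
    (fun g => if g = 1 then -(2 : ℤ) ^ 1 else 0) (1 + 1) (by decide)

/-- **`f_A` is fibre-independent**: its half-parity along `⟨i⟩` is `1`, and half-parities kill `rad2`. [folklore] -/
theorem fibreIndep_fA :
    LinearIndepOn (ZMod 2) (fun f : CMF G c →₀ ℤ => (rad2 c c_mul_c).mkQ (red c f))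
      (↑({gface c c_mul_c T (a 0) (xa 0)} : Finset (CMF G c →₀ ℤ))) := by
  rw [coe_singleton]
  refine LinearIndepOn.singleton fun h0 => ?_
  have hrad : red c (gface c c_mul_c T (a 0) (xa 0)) ∈ rad2 c c_mul_c := by
    rw [← Submodule.ker_mkQ (rad2 c c_mul_c)]
    exact LinearMap.mem_ker.mpr h0
  have h := LinearMap.mem_ker.mp (rad2_le_ker_hsum_of_mem_admHalves c c_mul_c ExampleQ8.mem_admHalves.1 hrad)
  rw [hsum_witness.1] at h
  exact one_ne_zero h

/-- `Q₈` is a `2`-group. [folklore] -/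
theorem isPGroup_two : IsPGroup 2 G := isPGroup_two_of_card (k := 3) (by rw [QuaternionGroup.card]; rfl)

/-- **THE LAW `μ(Q₈, −1) = φ₂(Q₈, −1)`**: the least number of rank-four face relations whose base changes generate the Hodge lattice of
`(Q₈, −1)` modulo pairs is EXACTLY the coinvariant fibre dimension. [folklore] -/
theorem isLeast_card_gfaces_generate_quaternionEight :
    IsLeast {n : ℕ | ∃ S : Finset (CMF G c →₀ ℤ), (↑S ⊆ gfaceSet G c c_mul_c) ∧ S.card = n ∧
      hodgeSpan c c_mul_c ≤ Submodule.span ℤ (pairSet c) ⊔ Submodule.span ℤ (translates c S)} (fibreTwo c c_mul_c) :=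
  isLeast_card_gfaces_generate_of_reduction c isPGroup_two c_mul_c c_ne_one c_comm T nondegenerate_T
    {gface c c_mul_c T (a 0) (xa 0)} (by rw [coe_singleton, Set.singleton_subset_iff]; exact fA_mem_gfaceSet) fibreIndep_fA 1 reduction

/-- **A generating family through `f_A`** of exactly `φ₂(Q₈, −1)` faces exists. [folklore] -/
theorem exists_generate_quaternionEight :
    ∃ S : Finset (CMF G c →₀ ℤ), gface c c_mul_c T (a 0) (xa 0) ∈ S ∧ (↑S ⊆ gfaceSet G c c_mul_c) ∧ S.card = fibreTwo c c_mul_c ∧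
      hodgeSpan c c_mul_c ≤ Submodule.span ℤ (pairSet c) ⊔ Submodule.span ℤ (translates c S) := by
  obtain ⟨S, hsub, hS, hcard, hgen⟩ := exists_generate_of_reduction c isPGroup_two c_mul_c c_ne_one c_comm T nondegenerate_T
    {gface c c_mul_c T (a 0) (xa 0)} (by rw [coe_singleton, Set.singleton_subset_iff]; exact fA_mem_gfaceSet) fibreIndep_fA 1 reduction
  exact ⟨S, hsub (mem_singleton_self _), hS, hcard, hgen⟩

/-- **`φ₂(Q₈, −1) ≥ 2`**: two faces are necessary (the blocks of `T` and `TfA` are distinct, two independent half-parities (gen 30), and the half-parity floor `β + t ≤ φ₂ + 2`). [folklore] -/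
theorem two_le_fibreTwo : 2 ≤ fibreTwo c c_mul_c := by
  have hne : blk c T ≠ blk c TfA := by
    intro h
    obtain ⟨Q, hQ⟩ := exists_rt_eq_of_blk_eq c h
    revert hQ; revert Q; decide
  have hβ : 2 ≤ Fintype.card (Block c) := Fintype.one_lt_card_iff.mpr ⟨blk c T, blk c TfA, hne⟩
  have h := card_block_add_halfRank_le_fibreTwo_add_two c c_mul_c c_ne_one
  have ht := two_le_halfRank
  omega

end

end Summit.HodgeConjecture.CorCM.Census.QuaternionEight
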